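import Literature.NumberTheory.EllipticCurves.ZpExtensionGaloisTwistLocalKummer
import Literature.NumberTheory.EllipticCurves.ZpExtensionGaloisTwistSelmerStructure
import HarnessLib

/-!
# The SIGNED twisted Selmer structures `𝓕^A ≤ 𝓖^A` on `E[p^J](χ_u)` over a number field: local Kummer
# condition cut out by subgroups of points `A_v ⊆ E(K̄_v)` at `v ∣ p`, prescribed values at `S₀`
# (definitions with bodies + bookkeeping for `SelmerComplement`)

Topic `NumberTheory/EllipticCurves` (next to `ZpExtensionGaloisTwistSelmerStructure`, whose structures are the
case "no condition at the omitted primes `S₀`, FULL Kummer condition `A = ⊤` at `v ∣ p`"); namespace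
`WeierstrassCurve`. DEFINITIONS WITH BODIES + theorems; no named fact, no instance, no notation.

Greenberg (LNM 1716, §4 p. 124) obtains the surjectivity of `γ : H¹(F_Σ/F, A_s) → 𝒫^Σ(A_s, F)` from
Poitou–Tate duality; for Kobayashi's signed Selmer groups at a supersingular prime the local condition at
`v ∣ p` is the Kummer image of the `±`-points `E^±((K_∞)_w) = ⋃ₙ E^±((K_n)_w)` (Kobayashi 2003, Def. 1.1), which
at finite level `M_J = E[p^J](χ_u)` over the number field `K` is the local condition
`W.twistedTorsionLocalKummer p κ J u hu K_v A_v` of `ZpExtensionGaloisTwistLocalKummer` for `A_v = ⋃ₙ E^±((K_n)_w)`.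
This file packages, for an ARBITRARY family `A = (A_v)_v` of subgroups `A_v ⊆ E(K̄_v)` (used only at `v ∣ p`),
the pair of Selmer structures in the currency of the tree's Poitou–Tate fact
(`poitouTate_selmerStructure_duality`, `LocalInvariants.SelmerComplement`):

* `W.twistedSignedSelmerStructure p S₀ κ J u hu A = 𝓕^A`: NOTHING at the infinite places (`⊤`), the ZERO
  condition (`⊥`) at the finite places of `S₀` (so that `SelmerComplement` for `𝓕^A ≤ 𝓖^A` PRESCRIBES the local
  classes at `S₀` exactly — the shape of Greenberg–Vatsal's surjectivity `H¹(ℚ_Σ/ℚ_∞) ↠ ∏_{S₀} 𝒫_v` read at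
  finite level), the local Kummer condition cut out by `A_v` at `v ∋ p`, `v ∉ S₀`, unramified classes elsewhere;
* `W.twistedSignedRelaxedSelmerStructure p S₀ κ J u hu A = 𝓖^A`: the same with EVERYTHING at `S₀`;
* bookkeeping: unfolding lemmas, `𝓕^A ≤ 𝓖^A`, both unramified outside `twistedDescentPlaces p S₀`
  (`IsUnramifiedOutside`), what membership in `H¹_{𝓖^A}` says at the places prime to `p` outside `S₀`
  (unramified) and at `v ∋ p` (the local Kummer condition), and what `loc_v x − t_v ∈ 𝓕^A_v` says at `v ∈ S₀`
  (`loc_v x = t_v`).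

Not here (proofs files): the `SelmerComplement` lifting with prescribed classes at `S₀`, its EVENTUAL form along
the change of level `ι`, the identification of the dual structure. References: R. Greenberg, LNM 1716 (1999), §4
pp. 122–124 [GreenbergLNM1716]; S. Kobayashi, Invent. math. 152 (2003), Def. 1.1 [Kobayashi2003]; B. Howard,
Compositio Math. 140 (2004), Def. 2.1.10 [Howard2004HeegnerKolyvagin].
-/

noncomputable section

open scoped Classical

open NumberField IsDedekindDomain Field
open Literature.NumberTheory.EllipticCurves Literature.NumberTheory.GaloisRepresentations
  Literature.NumberTheory.GaloisCohomology
open Literature.NumberTheory.GaloisRepresentations.DiscreteGaloisModule (unramifiedSubgroup SelmerStructure)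

universe u

namespace WeierstrassCurve

variable {K : Type u} [Field K] [NumberField K] (W : WeierstrassCurve K) (p : ℕ) [Fact p.Prime]
  (S₀ : Finset (HeightOneSpectrum (𝓞 K))) (κ : ZpExtension K p) (J : ℕ) (u : ℤ) (hu : (p : ℤ) ∣ u - 1)
  (A : ∀ v : HeightOneSpectrum (𝓞 K), AddSubgroup (localPoints W (v.adicCompletion K)))

/-! ## The two structures -/

/-- **`𝓕^A`, the signed twisted Selmer structure with prescribed values at `S₀`** on `M_J = E[p^J](χ_u)`:
nothing at the infinite places, the zero condition at `v ∈ S₀`, the local Kummer condition cut out by `A_v` at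
`v ∋ p` (`v ∉ S₀`), unramified classes at every other finite place. [cite: GreenbergLNM1716, §4 pp. 122–124]
[cite: Kobayashi2003, Def. 1.1] -/
def twistedSignedSelmerStructure : SelmerStructure (W.twistedTorsionGaloisModule p κ J u hu) := fun v =>
  match v with
  | Sum.inl _ => ⊤
  | Sum.inr v =>
      if v ∈ S₀ then ⊥
      else if ((p : ℕ) : 𝓞 K) ∈ v.asIdeal then
        W.twistedTorsionLocalKummer p κ J u hu (v.adicCompletion K) (A v)
      else unramifiedSubgroup (GaloisRep.toLocal v (W.twistedTorsionGaloisModule p κ J u hu)) 1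

/-- **`𝓖^A`, the signed twisted Selmer structure relaxed at `S₀`**: everything at `∞` and at `S₀`, the local
Kummer condition cut out by `A_v` at `v ∋ p` (`v ∉ S₀`), unramified elsewhere — `H¹_{𝓖^A}(K, M_J)` is the
level-`K` twisted signed Selmer group with no condition at `S₀`. [cite: GreenbergLNM1716, §4 pp. 122–124]
[cite: Kobayashi2003, Def. 1.1] -/
def twistedSignedRelaxedSelmerStructure : SelmerStructure (W.twistedTorsionGaloisModule p κ J u hu) := fun v =>
  match v with
  | Sum.inl _ => ⊤
  | Sum.inr v =>
      if v ∈ S₀ then ⊤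
      else if ((p : ℕ) : 𝓞 K) ∈ v.asIdeal then
        W.twistedTorsionLocalKummer p κ J u hu (v.adicCompletion K) (A v)
      else unramifiedSubgroup (GaloisRep.toLocal v (W.twistedTorsionGaloisModule p κ J u hu)) 1

/-! ## Unfolding lemmas -/

/-- `𝓕^A` at an infinite place: no condition. [cite: GreenbergLNM1716, §4 p. 123] -/
@[simp] theorem twistedSignedSelmerStructure_inl (w : InfinitePlace K) :
    W.twistedSignedSelmerStructure p S₀ κ J u hu A (Sum.inl w) = ⊤ := rfl

/-- `𝓖^A` at an infinite place: no condition. [cite: GreenbergLNM1716, §4 p. 123] -/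
@[simp] theorem twistedSignedRelaxedSelmerStructure_inl (w : InfinitePlace K) :
    W.twistedSignedRelaxedSelmerStructure p S₀ κ J u hu A (Sum.inl w) = ⊤ := rfl

/-- `𝓕^A` at `v ∈ S₀`: the zero condition. [cite: GreenbergLNM1716, §4 p. 123] -/
theorem twistedSignedSelmerStructure_inr_of_mem {v : HeightOneSpectrum (𝓞 K)} (hv : v ∈ S₀) :
    W.twistedSignedSelmerStructure p S₀ κ J u hu A (Sum.inr v) = ⊥ := by
  simp only [twistedSignedSelmerStructure, hv, if_true]

/-- `𝓖^A` at `v ∈ S₀`: no condition. [cite: GreenbergLNM1716, §4 p. 123] -/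
theorem twistedSignedRelaxedSelmerStructure_inr_of_mem {v : HeightOneSpectrum (𝓞 K)} (hv : v ∈ S₀) :
    W.twistedSignedRelaxedSelmerStructure p S₀ κ J u hu A (Sum.inr v) = ⊤ := by
  simp only [twistedSignedRelaxedSelmerStructure, hv, if_true]

/-- `𝓕^A` at `v ∋ p`, `v ∉ S₀`: the local Kummer condition cut out by `A_v`. [cite: Kobayashi2003, Def. 1.1] -/
theorem twistedSignedSelmerStructure_inr_of_mem_asIdeal {v : HeightOneSpectrum (𝓞 K)} (hv : v ∉ S₀)
    (hpv : ((p : ℕ) : 𝓞 K) ∈ v.asIdeal) :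
    W.twistedSignedSelmerStructure p S₀ κ J u hu A (Sum.inr v) =
      W.twistedTorsionLocalKummer p κ J u hu (v.adicCompletion K) (A v) := by
  simp only [twistedSignedSelmerStructure, hv, if_false, hpv, if_true]

/-- `𝓖^A` at `v ∋ p`, `v ∉ S₀`: the local Kummer condition cut out by `A_v`. [cite: Kobayashi2003, Def. 1.1] -/
theorem twistedSignedRelaxedSelmerStructure_inr_of_mem_asIdeal {v : HeightOneSpectrum (𝓞 K)} (hv : v ∉ S₀)
    (hpv : ((p : ℕ) : 𝓞 K) ∈ v.asIdeal) :
    W.twistedSignedRelaxedSelmerStructure p S₀ κ J u hu A (Sum.inr v) =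
      W.twistedTorsionLocalKummer p κ J u hu (v.adicCompletion K) (A v) := by
  simp only [twistedSignedRelaxedSelmerStructure, hv, if_false, hpv, if_true]

/-- `𝓕^A` at a finite `v ∉ S₀` prime to `p`: unramified classes. [cite: Howard2004HeegnerKolyvagin, Def. 2.1.10] -/
theorem twistedSignedSelmerStructure_inr_of_not_mem {v : HeightOneSpectrum (𝓞 K)} (hv : v ∉ S₀)
    (hpv : ((p : ℕ) : 𝓞 K) ∉ v.asIdeal) :
    W.twistedSignedSelmerStructure p S₀ κ J u hu A (Sum.inr v) =
      unramifiedSubgroup (GaloisRep.toLocal v (W.twistedTorsionGaloisModule p κ J u hu)) 1 := by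
  simp only [twistedSignedSelmerStructure, hv, if_false, hpv]

/-- `𝓖^A` at a finite `v ∉ S₀` prime to `p`: unramified classes. [cite: Howard2004HeegnerKolyvagin, Def. 2.1.10] -/
theorem twistedSignedRelaxedSelmerStructure_inr_of_not_mem {v : HeightOneSpectrum (𝓞 K)} (hv : v ∉ S₀)
    (hpv : ((p : ℕ) : 𝓞 K) ∉ v.asIdeal) :
    W.twistedSignedRelaxedSelmerStructure p S₀ κ J u hu A (Sum.inr v) =
      unramifiedSubgroup (GaloisRep.toLocal v (W.twistedTorsionGaloisModule p κ J u hu)) 1 := by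
  simp only [twistedSignedRelaxedSelmerStructure, hv, if_false, hpv]

/-- `𝓖^A` is everything at the places of `twistedDescentPlaces p S₀` that are infinite or in `S₀`.
[cite: GreenbergLNM1716, §4 p. 123] -/
theorem twistedSignedRelaxedSelmerStructure_eq_top_of_mem_of_not_mem_asIdeal {v : Place K}
    (hv : v ∈ twistedDescentPlaces (K := K) p S₀)
    (hp : ∀ v' : HeightOneSpectrum (𝓞 K), v = Sum.inr v' → ((p : ℕ) : 𝓞 K) ∈ v'.asIdeal → v' ∈ S₀) :
    W.twistedSignedRelaxedSelmerStructure p S₀ κ J u hu A v = ⊤ := by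
  cases v with
  | inl w => rfl
  | inr v =>
    rcases (inr_mem_twistedDescentPlaces_iff p S₀ v).1 hv with h | h
    · exact W.twistedSignedRelaxedSelmerStructure_inr_of_mem p S₀ κ J u hu A h
    · exact W.twistedSignedRelaxedSelmerStructure_inr_of_mem p S₀ κ J u hu A (hp v rfl h)

/-! ## `𝓕^A ≤ 𝓖^A`, both unramified outside `S` -/

/-- `𝓕^A ≤ 𝓖^A` (they differ only at `S₀`). [cite: Howard2004HeegnerKolyvagin, Def. 2.1.10] -/
theorem twistedSignedSelmerStructure_le_relaxed :
    W.twistedSignedSelmerStructure p S₀ κ J u hu A ≤ W.twistedSignedRelaxedSelmerStructure p S₀ κ J u hu A := by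
  intro v
  cases v with
  | inl w => exact le_rfl
  | inr v =>
    by_cases hv : v ∈ S₀
    · rw [W.twistedSignedRelaxedSelmerStructure_inr_of_mem p S₀ κ J u hu A hv]; exact le_top
    · by_cases hpv : ((p : ℕ) : 𝓞 K) ∈ v.asIdeal
      · rw [W.twistedSignedSelmerStructure_inr_of_mem_asIdeal p S₀ κ J u hu A hv hpv,
          W.twistedSignedRelaxedSelmerStructure_inr_of_mem_asIdeal p S₀ κ J u hu A hv hpv]
      · rw [W.twistedSignedSelmerStructure_inr_of_not_mem p S₀ κ J u hu A hv hpv,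
          W.twistedSignedRelaxedSelmerStructure_inr_of_not_mem p S₀ κ J u hu A hv hpv]

/-- `𝓕^A` is a Selmer structure with `Σ(𝓕^A) ⊆ S`. [cite: Howard2004HeegnerKolyvagin, Def. 2.1.10] -/
theorem isUnramifiedOutside_twistedSignedSelmerStructure :
    (W.twistedSignedSelmerStructure p S₀ κ J u hu A).IsUnramifiedOutside (twistedDescentPlaces (K := K) p S₀) := by
  refine ⟨inl_mem_twistedDescentPlaces p S₀, fun v hv ↦ ?_⟩
  rw [not_mem_twistedDescentPlaces_iff] at hv
  exact W.twistedSignedSelmerStructure_inr_of_not_mem p S₀ κ J u hu A hv.1 hv.2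

/-- `𝓖^A` is a Selmer structure with `Σ(𝓖^A) ⊆ S`. [cite: Howard2004HeegnerKolyvagin, Def. 2.1.10] -/
theorem isUnramifiedOutside_twistedSignedRelaxedSelmerStructure :
    (W.twistedSignedRelaxedSelmerStructure p S₀ κ J u hu A).IsUnramifiedOutside
      (twistedDescentPlaces (K := K) p S₀) := by
  refine ⟨inl_mem_twistedDescentPlaces p S₀, fun v hv ↦ ?_⟩
  rw [not_mem_twistedDescentPlaces_iff] at hv
  exact W.twistedSignedRelaxedSelmerStructure_inr_of_not_mem p S₀ κ J u hu A hv.1 hv.2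

/-! ## What membership in `H¹_{𝓖^A}` and in `𝓕^A_v` say -/

/-- A class of `H¹_{𝓖^A}(K, M_J)` is unramified at every finite `v ∉ S₀` prime to `p`.
[cite: GreenbergLNM1716, §4 p. 124] -/
theorem res_mem_unramifiedSubgroup_of_mem_selmerGroup_signedRelaxed
    {x : galoisCohomology (W.twistedTorsionGaloisModule p κ J u hu) 1}
    (hx : x ∈ (W.twistedSignedRelaxedSelmerStructure p S₀ κ J u hu A).selmerGroup)
    {v : HeightOneSpectrum (𝓞 K)} (hv : v ∉ S₀) (hpv : ((p : ℕ) : 𝓞 K) ∉ v.asIdeal) :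
    galoisCohomology.res (W.twistedTorsionGaloisModule p κ J u hu) (v.adicCompletion K) 1 x ∈
      unramifiedSubgroup ((W.twistedTorsionGaloisModule p κ J u hu).restrictField (v.adicCompletion K)) 1 := by
  rw [SelmerStructure.mem_selmerGroup_iff] at hx
  have h := hx (Sum.inr v)
  rw [W.twistedSignedRelaxedSelmerStructure_inr_of_not_mem p S₀ κ J u hu A hv hpv] at h
  exact h

/-- A class of `H¹_{𝓖^A}(K, M_J)` satisfies the local Kummer condition cut out by `A_v` at every `v ∋ p` outside
`S₀`. [cite: Kobayashi2003, Def. 1.1] -/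
theorem res_mem_twistedTorsionLocalKummer_of_mem_selmerGroup_signedRelaxed
    {x : galoisCohomology (W.twistedTorsionGaloisModule p κ J u hu) 1}
    (hx : x ∈ (W.twistedSignedRelaxedSelmerStructure p S₀ κ J u hu A).selmerGroup)
    {v : HeightOneSpectrum (𝓞 K)} (hv : v ∉ S₀) (hpv : ((p : ℕ) : 𝓞 K) ∈ v.asIdeal) :
    galoisCohomology.res (W.twistedTorsionGaloisModule p κ J u hu) (v.adicCompletion K) 1 x ∈
      W.twistedTorsionLocalKummer p κ J u hu (v.adicCompletion K) (A v) := by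
  rw [SelmerStructure.mem_selmerGroup_iff] at hx
  have h := hx (Sum.inr v)
  rw [W.twistedSignedRelaxedSelmerStructure_inr_of_mem_asIdeal p S₀ κ J u hu A hv hpv] at h
  exact h

/-- At `v ∈ S₀`, `loc_v x − t_v ∈ 𝓕^A_v = 0` means `loc_v x = t_v`: the classes are PRESCRIBED at `S₀`.
[cite: GreenbergLNM1716, §4 p. 123] -/
theorem res_eq_of_sub_mem_twistedSignedSelmerStructure {v : HeightOneSpectrum (𝓞 K)} (hv : v ∈ S₀)
    {x : galoisCohomology (W.twistedTorsionGaloisModule p κ J u hu) 1}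
    {t : galoisCohomology ((W.twistedTorsionGaloisModule p κ J u hu).toLocal (Sum.inr v)) 1}
    (h : galoisCohomology.localization (W.twistedTorsionGaloisModule p κ J u hu) (Sum.inr v) 1 x - t ∈
      W.twistedSignedSelmerStructure p S₀ κ J u hu A (Sum.inr v)) :
    galoisCohomology.res (W.twistedTorsionGaloisModule p κ J u hu) (v.adicCompletion K) 1 x = t := by
  rw [W.twistedSignedSelmerStructure_inr_of_mem p S₀ κ J u hu A hv, AddSubgroup.mem_bot, sub_eq_zero] at h
  exact h

end WeierstrassCurve

end
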